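import Summits.BirchSwinnertonDyer.Rank1Residual.X11a.PrintHidaMembersRoad
import Summits.BirchSwinnertonDyer.Rank1Residual.X11a.MainConjecture
import HarnessLib

/-!
# Class X11a, PRINT tier, seat p1: WHERE road p1's typed input is open — the Eisenstein half is
# exactly the lower half on the surjective sub-leaf, holds from print on the unit cells, and the
# transfer shape is equivalent to it (referee ruling R0-8, landed)

Cell `bsd-print-x11a` (run/shared/lean/pub/bsd-print-x11a/), prover seat p1. THEOREMS ONLY (no
definition, no named fact, no `sorry`); nothing asserted about any curve; no label moves. This file
closes the bookkeeping of road p1 («Skinner 2016 Thm C variants BY NAME with the ramified-prime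
hypothesis removed via BCS 2024 base change: type + discharge») by locating its typed input
`X11a.EisensteinHalfAt W p` EXACTLY:

* `eisensteinHalfAt_of_missingLowerBoundAt` / `eisensteinHalfAt_iff_missingLowerBoundAt` — at an
  X11a pair with `p ≥ 5` and `ρ̄_{E,p}` onto, the Eisenstein half IS the lower half
  `Typed.MissingLowerBoundAt W p` (`ord_p #Ш_an ≤ ord_p #Ш`, the body of crux 19064 `X11aLowerHalf` at
  the pair), granted the PUBLISHED facts (A32, Stein–Wuthrich 2013 Thm. 6.1 ×2 and THE §4.2 heights,
  Greenberg–Stevens, GZK, modularity): tree `mazurMainConjectureAt_of_missingLowerBoundAt` one way,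
  `missingLowerBoundAt_of_eisensteinHalf` the other;
* `CellPub.eisensteinHalfAt` — on the PUBLISHED sub-cell (`p ≥ 5`, `ρ̄` onto, `p ∤ #Ш_an`) the
  Eisenstein half HOLDS from print (Wuthrich 2014 Prop. 21 ⇒ `BSD(E,p)` ⇒ Mazur's main conjecture ⇒
  the half): road p1's input is OPEN exactly on `Leaf ∧ Surj` (`p ∣ #Ш_an`) — 2 pairs below
  `N < 2·10⁴`, 158 below `5·10⁵` (cell census), class-wide = Greenberg's `μ`-conjecture / B3;
* `hidaMembersTransferAt_of_eisensteinHalfAt` / `hidaMembersTransferAt_iff_eisensteinHalfAt` — the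
  REFEREE's ruling R0-8 (HOME/REF-R0-8-HidaCostume.lean, referee seat bsd-print-x11a-ref, 13:46Z),
  landed verbatim with attribution: the shape `HidaMembersTransferAt W p` of
  `PrintHidaMembersTransfer.lean` is implied by its own output via the degenerate witnesses `S = Λ`,
  `φ = id`, `P = 1`, `M = N_m = Λ ⧸ (T^e · ch X)`, `u = 1`, `L_m = G`; hence the shape is a
  BOOKKEEPING form of the Eisenstein half, NOT a crux — its content lives only in an instantiation by
  the CONCRETE Hida members (`Skinner2016.HidaCongruentMember`) with THEIR OWN `p`-adic `L`-functions in
  an intrinsic normalisation (Skinner Prop. 10: the two-variable `𝓛_𝕗` of the branch through `f_E`;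
  Emerton–Pollack–Weston §3), vocabulary the tree does not yet have at a `p`-new base point.

References: [Skinner2016PacificMC] §3.1–3.3, Prop. 10; [Wuthrich2014] Prop. 21, Thm. 3, Cor. 19;
[SteinWuthrich2013] Thm. 6.1; [GreenbergLNM1716] §4; [Miller2011LMS] Def. 1.1; referee file
HOME/REF-R0-8-HidaCostume.lean; companion files of seat p1 (p532019, p533431, p534028, p535822).
-/

set_option autoImplicit false

noncomputable section

open scoped Classical MatrixGroups ModularForm

open CongruenceSubgroup WeierstrassCurve PowerSeries Literature.NumberTheory.EllipticCurves
  Literature.NumberTheory.EllipticCurves.ModularForms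
  Literature.NumberTheory.EllipticCurves.Rank1Residual
  Literature.NumberTheory.EllipticCurves.Rank1Residual.Typed
  Literature.NumberTheory.EllipticCurves.Wuthrich2014
  Literature.NumberTheory.EllipticCurves.SteinWuthrich2013
  Literature.RingTheory.FittingIdeal

namespace Summit.BirchSwinnertonDyer.Rank1Residual.X11a

variable (W : WeierstrassCurve ℚ) [W.IsElliptic] [W.IsGloballyMinimal] (p : ℕ) [Fact p.Prime]

/-! ### The Eisenstein half = the lower half, on the surjective sub-leaf -/

/-- **The lower half gives the Eisenstein half** at a rank-`0` pair with `p ≥ 5` multiplicative and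
`ρ̄_{E,p}` onto: `MissingLowerBoundAt` ⇒ Mazur's main conjecture (tree
`mazurMainConjectureAt_of_missingLowerBoundAt`: Kato A32 + Stein–Wuthrich ×2 with THE heights +
Greenberg–Stevens + GZK + modularity) ⇒ the half (`eisensteinHalfAt_of_mazurMainConjectureAt`).
[cite: Wuthrich2014, Thm. 3 and Cor. 19] [cite: SteinWuthrich2013, Thm. 6.1 (p. 20)] -/
theorem eisensteinHalfAt_of_missingLowerBoundAt
    (hKato : kato_charIdeal_dvd_multiplicative_of_surjective)
    (hJs : thm61_splitMultiplicative) (hJn : thm61_nonsplitMultiplicative)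
    (hHs : exists_isSplitMultCanonical) (hHn : exists_isMultCanonical)
    (hGZK : rank_eq_analyticRank_of_analyticRank_le_one) (hmod : hasEntireLFunction_rat)
    (hGS : greenberg_stevens (W := W) (p := p))
    (hp : 5 ≤ p) (hmult : W.HasMultiplicativeReductionAtPrime p) (hsurj : Surj W p)
    (hr : W.analyticRank = 0) (hlow : MissingLowerBoundAt W p) : EisensteinHalfAt W p :=
  eisensteinHalfAt_of_mazurMainConjectureAt W p
    (mazurMainConjectureAt_of_missingLowerBoundAt hKato hJs hJn hHs hHn hGZK hmod W p hGS hp hmult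
      hsurj hr hlow)

/-- **On `ClassX11a ∧ 5 ≤ p ∧ Surj` road p1's typed input IS the lower half** (the body of crux 19064
at the pair), granted the PUBLISHED facts: `EisensteinHalfAt W p ↔ Typed.MissingLowerBoundAt W p`.
[cite: Wuthrich2014, Thm. 3 and Cor. 19] [cite: SteinWuthrich2013, Thm. 6.1 (p. 20)] [cite: Miller2011LMS, Def. 1.1] -/
theorem eisensteinHalfAt_iff_missingLowerBoundAt (hNf : exists_isNewformOf)
    (hKato : kato_charIdeal_dvd_multiplicative_of_surjective)
    (hJs : thm61_splitMultiplicative) (hJn : thm61_nonsplitMultiplicative)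
    (hHs : exists_isSplitMultCanonical) (hHn : exists_isMultCanonical)
    (hGZK : rank_eq_analyticRank_of_analyticRank_le_one)
    (hGS : greenberg_stevens (W := W) (p := p))
    (hX : ClassX11a W p) (hp : 5 ≤ p) (hsurj : Surj W p) :
    EisensteinHalfAt W p ↔ MissingLowerBoundAt W p :=
  ⟨missingLowerBoundAt_of_eisensteinHalf W p hNf hKato hJs hJn hGZK hGS hX hp hsurj,
    eisensteinHalfAt_of_missingLowerBoundAt W p hKato hJs hJn hHs hHn hGZK
      (hasEntireLFunction_rat_of_exists_isNewformOf hNf) hGS hp hX.mult hsurj hX.analyticRank_eq_zero⟩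

/-- **On the PUBLISHED sub-cell `CellPub` (`p ≥ 5`, `ρ̄` onto, `p ∤ #Ш_an`) the Eisenstein half holds
from print**: Wuthrich 2014 Prop. 21 (`hWu`) gives `BSD(E,p)` there (`CellPub.bsdp`), hence Mazur's
main conjecture (`mazurMainConjectureAt_of_bsdp`) and the half. So road p1's typed input is OPEN
exactly on `Leaf ∧ Surj` (`p ∣ #Ш_an`). [cite: Wuthrich2014, Prop. 21 (p. 400)]
[cite: SteinWuthrich2013, Thm. 6.1 (p. 20)] -/
theorem CellPub.eisensteinHalfAt (hWu : sha_dvd_analyticSha)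
    (hKato : kato_charIdeal_dvd_multiplicative_of_surjective)
    (hJs : thm61_splitMultiplicative) (hJn : thm61_nonsplitMultiplicative)
    (hHs : exists_isSplitMultCanonical) (hHn : exists_isMultCanonical)
    (hGZK : rank_eq_analyticRank_of_analyticRank_le_one) (hmod : hasEntireLFunction_rat)
    (hGS : greenberg_stevens (W := W) (p := p)) (h : CellPub W p) : EisensteinHalfAt W p :=
  eisensteinHalfAt_of_mazurMainConjectureAt W p
    (mazurMainConjectureAt_of_bsdp hKato hJs hJn hHs hHn hGZK hmod W p hGS h.2.1 h.1.mult h.2.2.1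
      h.1.analyticRank_eq_zero (h.bsdp hWu hGZK hmod))

/-! ### Referee ruling R0-8: the transfer shape is equivalent to its output -/

/-- `(p) ⊆ Jac(Λ)` for `Λ = ℤ_p⟦T⟧` along the identity (local ring, `p` a non-unit constant).
(Referee file HOME/REF-R0-8-HidaCostume.lean, `ref_p_mem_jacobson`.) [folklore] -/
theorem span_C_p_map_id_le_jacobson :
    (Ideal.span {(C (p : ℤ_[p]) : IwasawaAlgebra p)}).map (RingHom.id (IwasawaAlgebra p)) ≤
      (⊥ : Ideal (IwasawaAlgebra p)).jacobson := by
  rw [Ideal.map_id, IsLocalRing.jacobson_eq_maximalIdeal ⊥ bot_ne_top, Ideal.span_le,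
    Set.singleton_subset_iff]
  show ¬ IsUnit (C (p : ℤ_[p]) : PowerSeries ℤ_[p])
  rw [PowerSeries.isUnit_iff_constantCoeff, PowerSeries.constantCoeff_C]
  exact PadicInt.p_nonunit

omit [W.IsElliptic] [W.IsGloballyMinimal] in
/-- **Referee ruling R0-8 (bsd-print-x11a-ref, 2026-08-27T13:46Z), landed verbatim: the shape
`HidaMembersTransferAt W p` follows from its own output `EisensteinHalfAt W p`** via the degenerate
witnesses `S = Λ`, `φ = id`, `P = 1`, `M = N_m = Λ ⧸ (T^e · ch X)` (whose Fitting ideal is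
`T^e · ch X`), `u = 1`, `L_m = G`. Consequently the shape is NOT a crux or sub-crux: its content is
carried only by an instantiation on the CONCRETE Hida members with their own `p`-adic `L`-functions.
(Source: HOME/REF-R0-8-HidaCostume.lean, `hidaMembersTransferAt_of_eisensteinHalfAt`; author the
cell's referee seat; landed by p1 with attribution.) [folklore] -/
theorem hidaMembersTransferAt_of_eisensteinHalfAt (h : EisensteinHalfAt W p) :
    HidaMembersTransferAt W p := by
  intro κ γ hκ hγ hγ' _N _ f hf D ϖ hϖ L hL
  obtain ⟨G, hG, hGle⟩ := h κ γ hκ hγ hγ' f hf D ϖ hϖ L hL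
  set I : Ideal (IwasawaAlgebra p) := Ideal.span {trivialZeroFactor W p} * D.charIdeal with hI
  refine ⟨G, 1, hG, one_ne_zero, IwasawaAlgebra p, inferInstance, inferInstance,
    RingHom.id _, span_C_p_map_id_le_jacobson p, fun x y hxy => by simpa using hxy,
    IwasawaAlgebra p ⧸ I, inferInstance, inferInstance, inferInstance,
    fun _ => IwasawaAlgebra p ⧸ I, fun _ => inferInstance, fun _ => inferInstance,
    fun _ => inferInstance, 1, fun _ => G, ?_, fun m _ => ⟨LinearEquiv.refl _ _⟩, fun m _ => ?_,
    fun m _ => by simp⟩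
  · -- `I ≤ Fitt₀(Λ ⧸ I)`
    intro x hx
    apply Module.mem_fittingIdeal_zero_quotient
    simpa [hI, mul_one, Ideal.map_id] using hx
  · -- `Fitt₀(Λ ⧸ I) ≤ Ann(Λ ⧸ I) = I ≤ (G)`
    refine (Module.fittingIdeal_zero_le_annihilator).trans (fun x hx => ?_)
    have h2 : x ∈ I := by
      have hx' : x ∈ Module.annihilator (IwasawaAlgebra p) (IwasawaAlgebra p ⧸ I) := hx
      rwa [Ideal.annihilator_quotient] at hx'
    exact hGle h2

omit [W.IsElliptic] [W.IsGloballyMinimal] in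
/-- **`HidaMembersTransferAt W p ↔ EisensteinHalfAt W p`** (referee R0-8 with p1's
`eisensteinHalfAt_of_hidaMembersTransferAt`): the shape is a bookkeeping form of the half. [folklore] -/
theorem hidaMembersTransferAt_iff_eisensteinHalfAt :
    HidaMembersTransferAt W p ↔ EisensteinHalfAt W p :=
  ⟨eisensteinHalfAt_of_hidaMembersTransferAt W p, hidaMembersTransferAt_of_eisensteinHalfAt W p⟩

end Summit.BirchSwinnertonDyer.Rank1Residual.X11a

end
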